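import Summits.BirchSwinnertonDyer.Rank1Residual.X11b.IntSeriesValueRigidityOneSided
import Summits.BirchSwinnertonDyer.Rank1Residual.X11b.BDPRouteOpenInputSplitRecord
import HarnessLib

/-!
# Class X11b, route p2 at `p ≥ 5`: the VALUE SHAPE `P2.BDPValueSomeFrameOnTree` from Hsieh 2014 and
# a value theorem in CONTINUOUS-FUNCTION currency — the consumer shape of trigger (b) (cell
# `b2b-bsdres`, sub-cell `multr1-p2`, gen 25)

HONEST FRAMING (cell `b2b-bsdres`, run/shared/lean/b2b/bsd-rank1-residual/, verbatim in every
file): the goal of the cell is to DELETE the COMBINATION-SHAPED residual classes of the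
Birch–Swinnerton-Dyer formula for ALL analytic-rank `≤ 1` elliptic curves over `ℚ` — "full BSD
formula for every rank `≤ 1` curve in class `C`" assembled STRICTLY from published theorems — so
that the rank-`≤ 1` remainder becomes exactly the CONSTRUCTION-SHAPED classes, which are TYPED
(missing-input `Prop`s), NOT attempted. This is not "finishing BSD". Sub-cell `multr1-p2` is a
RESEARCH ROUTE on class X11b (`ClassX11b W p := r_an = 1 ∧ p ≠ 2 ∧ mult(p) ∧ irr(p)`); no claim
beyond the stated class and loci; X11b's label does not change; NOTHING is booked by this file.

THEOREMS ONLY (no definition, no named fact, no `sorry`). The PUBLISHED fact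
`hsieh2014_exists_anticyclotomicPAdicLFunction` is consumed as a hypothesis `hH`; the continuity /
value input is an explicit HYPOTHESIS (no def) whose intended source is [cas-split] = Castella, JIMJ
2018, Thms. 2.10–2.11 (split `p ≥ 5`, any tame level; typed by lit as a CONTINUOUS function on
characters — request filed 2026-08-21, INBOX) or [Castella 2024] (PREPRINT).

## What this file proves

**`P2.bdpValueSomeFrameOnTree_of_hsieh2014_of_continuousDisplay`**: route p2's value shape
`P2.BDPValueSomeFrameOnTree W p` (per datum SOME ♭-frame with Castella's interpolation and the BDP
value at `𝟙`) holds as soon as, at every datum, for SOME non-zero "virtual periods" `(Ω_K, Ω_p)` and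
some `u` with `‖u‖ = 1`, Castella's display `ι'⁻¹(bdpInterpolationValue p f_{Dt} 𝔭_{ι'} φ n Ω_K)·Ω_p^{4n}`
is CONTINUOUS AT `𝟙` along every interpolation sequence `(φ_k, n_k, r_k)` with `r_k(γ) → 1`, with
limit `u·((1 − a_p p⁻¹)·log_{ω_E} P')² ≠ 0`: the frame is Hsieh's (gen 25:
`P2.exists_isBDPLFunctionInt_datum_of_hsieh2014_supplied`, Castella-normalised, `‖Ω_p'‖ = 1`) and its
constant term is the limit by ONE-SIDED ♭-V1RIG
(`intSeries_constantCoeff_eq_of_isBDPLFunctionInt_of_continuousValues`). With §1 of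
`BDPRouteOpenInputSplitRecord`, the class record would then type ONLY (2.4)∃♭ on every pair where
such a continuity/value statement is printed. CONDITIONAL; nothing booked; labels UNCHANGED.

## References

* [Castella2018] Thms. 3.1–3.2 (arXiv:1704.06608 pp. 8–9). * [Hsieh2014] Thm. 1.
* [CastellaHsieh2018] §3.3 (continuous-function currency of `ℒ_p(f)`).
-/

noncomputable section

open scoped Classical NumberField Topology

open Filter WeierstrassCurve NumberField IsDedekindDomain Field PowerSeries
open Literature.NumberTheory.EllipticCurves Literature.NumberTheory.EllipticCurves.GreenbergSelmer
open Literature.NumberTheory.EllipticCurves.ModularForms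
open Literature.NumberTheory.EllipticCurves.Rank1Residual
open Literature.NumberTheory.EllipticCurves.Rank1Residual.Typed
open Literature.NumberTheory.EllipticCurves.Castella2018
open Literature.NumberTheory.QuadraticFields.Quadratic
open Literature.NumberTheory.GaloisRepresentations Literature.NumberTheory.GaloisCohomology
open Literature.NumberTheory.Automorphic
open Summit.BirchSwinnertonDyer.Rank1Residual.X11b.AcSelmer
open Summit.BirchSwinnertonDyer.Rank1Residual.X11b.Halves

namespace Summit.BirchSwinnertonDyer.Rank1Residual.X11b

variable {W : WeierstrassCurve ℚ} [W.IsElliptic] [W.IsGloballyMinimal] {p : ℕ} [Fact p.Prime]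

/-- **route p2's VALUE SHAPE from Hsieh 2014 + a value theorem in continuous-function currency.**
See the module docstring. The per-datum hypothesis `hC` asks for virtual periods `(Ω_K ≠ 0, Ω_p ≠ 0)`,
a `u` with `‖u‖ = 1`, the non-vanishing of the BDP value `c = u·((1 − a_p p⁻¹)·log_{ω_E} P')²`, and
the CONTINUITY AT `𝟙` of Castella's display along every interpolation sequence `(φ_k, n_k, r_k)` with
`r_k(γ) → 1`, with limit `c`. CONDITIONAL on `hH` (published) and `hC` (to be sourced); nothing booked.
[cite: Hsieh2014, Thm. 1 (arXiv:1112.1580 pp. 3–4)] [cite: Castella2018, Thms. 3.1–3.2 (arXiv:1704.06608 p. 9)] -/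
theorem P2.bdpValueSomeFrameOnTree_of_hsieh2014_of_continuousDisplay
    (hH : hsieh2014_exists_anticyclotomicPAdicLFunction)
    (hC : ∀ (N : ℕ) [NeZero N] (K : Type) [Field K] [NumberField K]
      (Dt : ModularParametrizationData W N) (H : HeegnerDatum N (NumberField.discr K)) (ι : K →+* ℂ)
      (P : (W.baseChange K).toAffine.Point),
      ClassX11b W p → 5 ≤ p → Surj W p → W.conductorNorm ℤ = N → IsImaginaryQuadratic K →
      Odd (NumberField.discr K) → ¬ (p : ℤ) ∣ NumberField.discr K → ¬ p ∣ Units.torsionOrder K →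
      SatisfiesHeegnerHypothesis N K →
      (W.quadraticTwist (NumberField.discr K : ℚ)).entireLFunction 1 ≠ 0 →
      WeierstrassCurve.Affine.Point.map ι.toRatAlgHom P = heegnerPointComplex Dt H →
      ¬ (p : ℤ) ∣ Dt.c → ¬ IsOfFinAddOrder P →
      ∀ (κ : ZpExtension K p), κ.IsAnticyclotomic →
        ∀ (γ : Field.absoluteGaloisGroup K) [Fact (κ.IsTopGenerator γ)]
          (ι' : PadicAlgCl p ≃+* ℂ) (w₀ : InfinitePlace K) (P' : (W.baseChange K).toAffine.Point),
          WeierstrassCurve.Affine.Point.map w₀.embedding.toRatAlgHom P' = heegnerPointComplex Dt H →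
          ∀ (e : K →+* ℚ_[p]),
            (∀ k : 𝓞 K, k ∈ (primeOfEmbeddingDatum p ι' w₀.embedding).asIdeal ↔ ‖e (k : K)‖ < 1) →
            ∃ (ΩK : ℂ) (Ωp u : ℂ_[p]), ΩK ≠ 0 ∧ Ωp ≠ 0 ∧ ‖u‖ = 1 ∧
              u * (algebraMap ℚ_[p] ℂ_[p] (((1 : ℚ_[p]) - ((W.LFunction p : ℤ) : ℚ_[p]) *
                (p : ℚ_[p])⁻¹) * logOmega W p e P')) ^ 2 ≠ 0 ∧
              ∀ (φ : ℕ → HeckeCharacter K) (n : ℕ → ℕ) (r : ℕ → FramedGaloisRep K (PadicAlgCl p) 1),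
                (∀ k, 0 < n k) → (∀ k (v : HeightOneSpectrum (𝓞 K)), (φ k).IsUnramifiedAt v) →
                (∀ k, (φ k).HasInfinityType (fun _ ↦ (n k : ℤ)) (fun _ ↦ -(n k : ℤ))) →
                (∀ k, IsPAdicAvatarOf ι' (φ k) (r k)) → (∀ k, FactorsThroughZp κ (r k)) →
                Tendsto (fun k ↦ avatarValueAt (r k) γ) atTop (𝓝 1) →
                Tendsto (fun k ↦ ((ι'.symm (bdpInterpolationValue p Dt.f
                  (primeOfEmbeddingDatum p ι' w₀.embedding) (φ k) (n k) ΩK) : PadicAlgCl p) : ℂ_[p]) *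
                  Ωp ^ (4 * n k)) atTop
                  (𝓝 (u * (algebraMap ℚ_[p] ℂ_[p] (((1 : ℚ_[p]) - ((W.LFunction p : ℤ) : ℚ_[p]) *
                    (p : ℚ_[p])⁻¹) * logOmega W p e P')) ^ 2))) :
    P2.BDPValueSomeFrameOnTree W p := by
  intro N _ K _ _ Dt H ιK P hX h5 hs hN hK hodd hpd hμ hHN hLt hP hc hPinf κ hκ γ hγ ι' w₀ P' hP' e he
  -- Hsieh's frame, Castella-normalised
  obtain ⟨ΩK', Ωp', Q', hΩK', hΩp', hQ'⟩ :=
    P2.exists_isBDPLFunctionInt_datum_of_hsieh2014_supplied W p hH Dt hX hN hK hHN κ hκ γ ι' w₀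
  have hΩp0' : Ωp' ≠ 0 := fun h ↦ by rw [h, norm_zero] at hΩp'; exact zero_ne_one hΩp'
  -- the continuity / value input at the datum
  obtain ⟨ΩK, Ωp, u, hΩK, hΩp, hu, hc0, hcont⟩ :=
    hC N K Dt H ιK P hX h5 hs hN hK hodd hpd hμ hHN hLt hP hc hPinf κ hκ γ ι' w₀ P' hP' e he
  have heq := intSeries_constantCoeff_eq_of_isBDPLFunctionInt_of_continuousValues hX.2.1 hK hκ hγ.out
    hΩK hΩK' hΩp hΩp0' hcont hc0 hQ'
  refine ⟨ΩK', Ωp', Q', hΩK', hΩp', hQ', u, hu, ?_⟩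
  rw [← heq]
  exact R1.intSeries_hasValueAt_zero p Q'

end Summit.BirchSwinnertonDyer.Rank1Residual.X11b

end
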